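import Summits.QuantumFields.BalabanUV.T4Continuum.Support.NE3LocalReadoutsPair
import HarnessLib

/-!
# T⁴ programme, node NE3 — the LOCAL half, reading (D), CRUDE fixed-torus route, part 1:
# THE TWO-LEVEL LOCAL ACTION READ-OUT IN THE ORIENTATION OF THE ENERGY ROOT, AND THE GLOBAL-ENERGY SUMS

NE3 prover lineage P1, gen 18 (cell `pub-balaban`, unit `b2b-balaban-t4-ne3-p1`, `HOME/BINDER-OWNERS.md` row NE3 OWNER; journal NOTE
l.10685 «the local half (D) on a FIXED torus needs no localisation δ»).

WHY.  P2's ROOT `NE3EnergyShapes.NE3EnergyRate` (T-E) gives, for every level `k ≥ 1` and minimiser pair `(U_A, U_B)`, a site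
gauge `u` and a periodic skew direction `Z` with `U_A^u = W·e^Z`, `W = rescale L (bavg L U_B)`, and a GLOBAL energy bound
`energyNorm W Z (periodBox (N·L^k)) ≤ C·residualScale` — already geometric in `k` (rate `L⁻¹`, constant ∝ N² at d = 4).  The
co-owner roads localise this (Agmon ∕ Combes–Thomas) to get volume-free constants; for the cell's FIXED-torus target the
crude route «sup ≤ ℓ²» suffices.  THIS FILE (0 def, 0 sorry) is the per-pair read-out in T-E's orientation and the two sums
that reduce the direction terms to the GLOBAL energy norm:
§1 `windowAction_sub_eq'`, **`abs_windowAction_sub_le'`** — leaf-01-g2's (D) read-out (`NE3LocalReadoutsPair`) re-run with the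
   hypothesis `gaugeAct u U_A = vary W Z 1` (T-E's form; gauge invariance `fineAction_gaugeAct` on `U_A`'s side):
   `|L^{d−4}A_Y(U_A) − A_{B(Y)}(U_B)| ≤ β′-loc(U_B on N_{2L}(B(Y))) + L^{d−4}(a_W·Σ_{p∈Y×pl}‖(d_W Z)(p)‖ + (7/2)·Σ bondSq Z)`;
§2 `sum_le_sqrt_card_mul_sqrt` (Cauchy–Schwarz), `sum_norm_curl_le` (`Σ_{Y×pl}‖d_W Z‖ ≤ √(#Y·#Pl)·energyNorm W Z F` for `Y ⊆ F`),
   `sum_bondSq_periodBox_le` (`Σ_{periodBox M × pl} bondSq Z ≤ 4·#Pl·dirSq Z (periodBox M)` for `M`-periodic `Z`, by the shift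
   invariance `sum_periodBox_shift`), `dirSq_le_energyNorm_sq`.
Part 2 bounds the β′-loc window terms from `RegularSup`; part 3 assembles `LocalRate … (L⁻¹)`.

HONEST FRAMING.  Bookkeeping over landed theorems; **NE3 is NOT proved**; T-E and the minimisers' regularity are hypotheses of
parts 2–3, nothing printed is a hypothesis; no conditional of the cell (`BetaPertH`, (B), (B^μ), G-an2-4); no `def`, no `sorry`,
axioms ⊆ {propext, Classical.choice, Quot.sound}.  Finite T⁴ rung (B)+1 — NOT infinite volume, NOT a mass gap, NOT the Clay
problem, NOT summit progress.  PLACEMENT (human rule 2026-08-19): `Summits/QuantumFields/BalabanUV/`.  HONEST DEPENDENCY (cell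
page 1): continuum YM on T⁴ ⇐ BetaPertH ∧ nine spine estimates (0/9 proved); BetaPertH ⇐ (D1) ∧ (D4) ∧ CAP+tail; G-an2-4 gates
asym, D1 and NE2/3/4.
-/

set_option autoImplicit false

open scoped BigOperators Matrix Matrix.Norms.L2Operator
open NormedSpace Finset

namespace Summit.QuantumFields.BalabanUV.T4Continuum.NE3LocalCrudePair

open Literature.MathematicalPhysics.QuantumFieldTheory.Balaban1983to89
open B7Prop1Explicit B7Prop2Explicit MatrixLog UnitaryModel
open T4AveragingDeficitWall hiding Site Plane Plaq Bond
open T4AveragingDeficitWallBoundary (gradFluxL1 periodBox sum_periodBox_shift)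
open T4AveragingDeficitNonAbelian (wallConstLoc abs_deficit_blockWindow_le)
open AveragingDeficitPeriodicCounting (IsPeriodicDir)
open MinimalActionLevels (fineAction_rescale_bavg)
open NE3EnergyShapes (energyNorm)
open NE3EnergyAssembly (fineAction_gaugeAct)
open NE3HessBounds (bondSq bondSqAt)
open NE3LocalReadouts (abs_fineAction_vary_sub_le)

noncomputable section

variable {d : ℕ} {n : Type*} [Fintype n] [DecidableEq n] [Nonempty n]

/-! ## §1 The read-out in the orientation of the energy root -/

omit [Nonempty n] in
/-- **THE (D) IDENTITY, T-E ORIENTATION**: if `U_A^u = W·e^Z` bondwise (`W = rescale L (bavg L U_B)`), then on every finite set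
`Y` of coarse sites `L^{d−4}·A_Y(U_A) − A_{B(Y)}(U_B) = 𝓓_{W(Y)}(U_B) + L^{d−4}·(A_Y(W·e^Z) − A_Y(W))`. [folklore] -/
theorem windowAction_sub_eq' (L : ℕ) {UB UA : Site d → Fin d → (Matrix n n ℂ)ˣ}
    {Z : Site d → Fin d → Matrix n n ℂ} {u : Site d → (Matrix n n ℂ)ˣ}
    (hrep : gaugeAct u UA = vary (rescale L (bavg L UB)) Z 1) (Y : Finset (Site d)) :
    (L : ℝ) ^ ((d : ℤ) - 4) * fineAction UA (Y ×ˢ Finset.univ) - fineAction UB (blockSites L Y ×ˢ Finset.univ)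
      = deficit L UB (blockWindow L Y)
        + (L : ℝ) ^ ((d : ℤ) - 4) * (fineAction (vary (rescale L (bavg L UB)) Z 1) (Y ×ˢ Finset.univ)
            - fineAction (rescale L (bavg L UB)) (Y ×ˢ Finset.univ)) := by
  have hA : fineAction UA (Y ×ˢ Finset.univ) = fineAction (vary (rescale L (bavg L UB)) Z 1) (Y ×ˢ Finset.univ) := by
    rw [← fineAction_gaugeAct u UA, hrep]
  simp only [deficit, blockWindow, ← fineAction_rescale_bavg]
  rw [hA]
  ring

/-- **THE TWO-LEVEL LOCAL ACTION READ-OUT, T-E ORIENTATION**: for `L ≥ 1`, `U_B` unitary in `SmallField U_B a_B` with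
`512(d+1)(d+4)L²a_B ≤ 1`, `W = rescale L (bavg L U_B)` unitary with plaquettes within `a_W` of `1` on `Y × planes`, a skew
direction `Z` and a site gauge `u` with `gaugeAct u U_A = vary W Z 1`:
`|L^{d−4}·A_Y(U_A) − A_{B(Y)}(U_B)| ≤ wallConstLoc·(a_B·‖∇F‖_{ℓ¹} + ‖∇F‖²_{ℓ²} + a_B³·#Y)(U_B on N_{2L}(B(Y)))
  + L^{d−4}·(a_W·Σ_{p∈Y×pl}‖(d_W Z)(p)‖ + (7/2)·Σ_{p∈Y×pl} bondSq Z p)`. [folklore] -/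
theorem abs_windowAction_sub_le' (L : ℕ) (hL : 1 ≤ L) {UB UA : Site d → Fin d → (Matrix n n ℂ)ˣ}
    (hUB : IsUnitaryCfg UB) (hW : IsUnitaryCfg (rescale L (bavg L UB))) {aB aW : ℝ} (haB : 0 ≤ aB)
    (hsmall : 512 * (d + 1) * (d + 4) * (L : ℝ) ^ 2 * aB ≤ 1) (hUBa : SmallField UB aB)
    {Z : Site d → Fin d → Matrix n n ℂ} (hZ : IsSkewDir Z) {u : Site d → (Matrix n n ℂ)ˣ}
    (hrep : gaugeAct u UA = vary (rescale L (bavg L UB)) Z 1) (Y : Finset (Site d))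
    (haW : ∀ p ∈ Y ×ˢ (Finset.univ : Finset (T4AveragingDeficitWall.Plane d)),
      ‖((fhol (rescale L (bavg L UB)) p : (Matrix n n ℂ)ˣ) : Matrix n n ℂ) - 1‖ ≤ aW) :
    |(L : ℝ) ^ ((d : ℤ) - 4) * fineAction UA (Y ×ˢ Finset.univ) - fineAction UB (blockSites L Y ×ˢ Finset.univ)|
      ≤ wallConstLoc d L * (aB * gradFluxL1 UB (nbhd (2 * L) (blockSites L Y))
            + gradFluxSq UB (nbhd (2 * L) (blockSites L Y)) + aB ^ 3 * Y.card)
        + (L : ℝ) ^ ((d : ℤ) - 4) * (aW * ∑ p ∈ Y ×ˢ Finset.univ, ‖curl (rescale L (bavg L UB)) Z p‖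
            + 7 / 2 * ∑ p ∈ Y ×ˢ Finset.univ, bondSq Z p) := by
  rw [windowAction_sub_eq' L hrep Y]
  have hD := abs_deficit_blockWindow_le L hL hUB haB hsmall hUBa Y
  have hA := abs_fineAction_vary_sub_le hW hZ (Y ×ˢ Finset.univ) haW
  have hw : 0 ≤ (L : ℝ) ^ ((d : ℤ) - 4) := zpow_nonneg (Nat.cast_nonneg L) _
  have hA' : |(L : ℝ) ^ ((d : ℤ) - 4)
      * (fineAction (vary (rescale L (bavg L UB)) Z 1) (Y ×ˢ Finset.univ)
          - fineAction (rescale L (bavg L UB)) (Y ×ˢ Finset.univ))|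
      ≤ (L : ℝ) ^ ((d : ℤ) - 4) * (aW * ∑ p ∈ Y ×ˢ Finset.univ, ‖curl (rescale L (bavg L UB)) Z p‖
            + 7 / 2 * ∑ p ∈ Y ×ˢ Finset.univ, bondSq Z p) := by
    rw [abs_mul, abs_of_nonneg hw]
    exact mul_le_mul_of_nonneg_left hA hw
  exact (abs_add_le _ _).trans (add_le_add hD hA')

/-! ## §2 The direction terms against the GLOBAL energy norm -/

omit [Fintype n] [DecidableEq n] [Nonempty n] in
/-- Cauchy–Schwarz: `Σ_{s∈S} f s ≤ √#S · √(Σ_{s∈S} f s²)` for `f ≥ 0`. [folklore] -/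
theorem sum_le_sqrt_card_mul_sqrt {ι : Type*} (S : Finset ι) {f : ι → ℝ} (hf : ∀ s ∈ S, 0 ≤ f s) :
    ∑ s ∈ S, f s ≤ Real.sqrt S.card * Real.sqrt (∑ s ∈ S, f s ^ 2) := by
  have hcs := Finset.sum_mul_sq_le_sq_mul_sq S (fun _ => (1 : ℝ)) f
  simp only [one_mul, one_pow, Finset.sum_const, nsmul_eq_mul, mul_one] at hcs
  have h0 : 0 ≤ ∑ s ∈ S, f s := Finset.sum_nonneg hf
  rw [← Real.sqrt_mul (Nat.cast_nonneg _), ← Real.sqrt_sq h0]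
  exact Real.sqrt_le_sqrt hcs

omit [Nonempty n] in
/-- The curl square-sum over `Y × planes` is `curlSq … Y`. [folklore] -/
theorem sum_curl_sq_eq (W : Site d → Fin d → (Matrix n n ℂ)ˣ) (Z : Site d → Fin d → Matrix n n ℂ) (Y : Finset (Site d)) :
    ∑ p ∈ Y ×ˢ (Finset.univ : Finset (T4AveragingDeficitWall.Plane d)), ‖curl W Z p‖ ^ 2 = curlSq W Z Y := by
  unfold curlSq
  rw [Finset.sum_product]

omit [Nonempty n] in
/-- `curlSq` is monotone in the site set. [folklore] -/
theorem curlSq_mono (W : Site d → Fin d → (Matrix n n ℂ)ˣ) (Z : Site d → Fin d → Matrix n n ℂ) {Y F : Finset (Site d)}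
    (h : Y ⊆ F) : curlSq W Z Y ≤ curlSq W Z F := by
  unfold curlSq
  exact Finset.sum_le_sum_of_subset_of_nonneg h fun _ _ _ => Finset.sum_nonneg fun _ _ => sq_nonneg _

omit [Nonempty n] in
/-- `dirSq` is monotone in the site set. [folklore] -/
theorem dirSq_mono (Z : Site d → Fin d → Matrix n n ℂ) {Y F : Finset (Site d)} (h : Y ⊆ F) : dirSq Z Y ≤ dirSq Z F := by
  unfold dirSq
  exact Finset.sum_le_sum_of_subset_of_nonneg h fun _ _ _ => Finset.sum_nonneg fun _ _ => sq_nonneg _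

omit [Nonempty n] in
/-- `curlSq ≤ energyNorm²` and `dirSq ≤ energyNorm²`. [folklore] -/
theorem curlSq_add_dirSq_eq_energyNorm_sq (W : Site d → Fin d → (Matrix n n ℂ)ˣ) (Z : Site d → Fin d → Matrix n n ℂ)
    (F : Finset (Site d)) : curlSq W Z F + dirSq Z F = energyNorm W Z F ^ 2 := by
  unfold NE3EnergyShapes.energyNorm
  have h0 : 0 ≤ curlSq W Z F + dirSq Z F := by
    unfold curlSq dirSq; positivity
  rw [Real.sq_sqrt h0]

omit [Nonempty n] in
/-- **THE CURL TERM AGAINST THE GLOBAL ENERGY NORM**: for `Y ⊆ F`,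
`Σ_{p∈Y×pl}‖(d_W Z)(p)‖ ≤ √(#Y·#Pl)·energyNorm W Z F`. [folklore] -/
theorem sum_norm_curl_le (W : Site d → Fin d → (Matrix n n ℂ)ˣ) (Z : Site d → Fin d → Matrix n n ℂ) {Y F : Finset (Site d)}
    (h : Y ⊆ F) :
    ∑ p ∈ Y ×ˢ (Finset.univ : Finset (T4AveragingDeficitWall.Plane d)), ‖curl W Z p‖
      ≤ Real.sqrt (Y.card * Fintype.card (T4AveragingDeficitWall.Plane d)) * energyNorm W Z F := by
  have h1 := sum_le_sqrt_card_mul_sqrt (Y ×ˢ (Finset.univ : Finset (T4AveragingDeficitWall.Plane d)))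
    (f := fun p => ‖curl W Z p‖) (fun _ _ => norm_nonneg _)
  rw [sum_curl_sq_eq, Finset.card_product, Finset.card_univ] at h1
  refine h1.trans ?_
  push_cast
  refine mul_le_mul_of_nonneg_left ?_ (Real.sqrt_nonneg _)
  rw [show energyNorm W Z F = Real.sqrt (energyNorm W Z F ^ 2) by
    rw [Real.sqrt_sq (NE3EnergyShapes.energyNorm_nonneg W Z F)]]
  refine Real.sqrt_le_sqrt ?_
  have h2 := curlSq_mono W Z h
  have h3 := curlSq_add_dirSq_eq_energyNorm_sq W Z F
  have h4 : 0 ≤ dirSq Z F := by unfold dirSq; positivity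
  linarith

omit [Nonempty n] in
/-- The `κ`-th bond square-sum over a finite set. [folklore] -/
theorem dirSq_eq_sum_comm (Z : Site d → Fin d → Matrix n n ℂ) (F : Finset (Site d)) :
    dirSq Z F = ∑ κ : Fin d, ∑ x ∈ F, ‖Z x κ‖ ^ 2 := by
  unfold dirSq
  rw [Finset.sum_comm]

omit [Nonempty n] in
/-- **THE BOND-SQUARE TERM AGAINST THE GLOBAL ℓ² NORM**: for an `M`-periodic direction `Z` (`M ≥ 1`),
`Σ_{p ∈ periodBox M × pl} bondSq Z p ≤ 4·#Pl·dirSq Z (periodBox M)` (each of the four bond sums of a plane is, after an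
`M`-periodic shift, one of the coordinate square-sums `s_μ`, `s_ν ≤ dirSq`). [folklore] -/
theorem sum_bondSq_periodBox_le {Z : Site d → Fin d → Matrix n n ℂ} (M : ℕ) (hM : 1 ≤ M)
    (hZ : IsPeriodicDir Z (M : ℤ)) :
    ∑ p ∈ periodBox M ×ˢ (Finset.univ : Finset (T4AveragingDeficitWall.Plane d)), bondSq Z p
      ≤ 4 * Fintype.card (T4AveragingDeficitWall.Plane d) * dirSq Z (periodBox M) := by
  -- coordinate square-sums and their shift invariance
  have hs : ∀ (κ : Fin d) (v : Site d), ∑ x ∈ periodBox M, ‖Z (x + v) κ‖ ^ 2 = ∑ x ∈ periodBox M, ‖Z x κ‖ ^ 2 :=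
    fun κ v => sum_periodBox_shift M hM (g := fun x => ‖Z x κ‖ ^ 2) (fun x μ => by rw [hZ x μ κ]) v
  have hle : ∀ κ : Fin d, ∑ x ∈ periodBox M, ‖Z x κ‖ ^ 2 ≤ dirSq Z (periodBox M) := by
    intro κ
    rw [dirSq_eq_sum_comm]
    exact Finset.single_le_sum (f := fun κ => ∑ x ∈ periodBox M, ‖Z x κ‖ ^ 2)
      (fun _ _ => Finset.sum_nonneg fun _ _ => sq_nonneg _) (Finset.mem_univ κ)
  rw [Finset.sum_product_right]
  have hplane : ∀ π : T4AveragingDeficitWall.Plane d,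
      ∑ z ∈ periodBox M, bondSq Z (z, π) ≤ 4 * dirSq Z (periodBox M) := by
    intro π
    obtain ⟨⟨μ, ν⟩, hlt⟩ := π
    have heq : ∑ z ∈ periodBox M, bondSq Z (z, ⟨(μ, ν), hlt⟩)
        = ∑ z ∈ periodBox M, ‖Z z μ‖ ^ 2 + ∑ z ∈ periodBox M, ‖Z (z + e μ) ν‖ ^ 2
          + ∑ z ∈ periodBox M, ‖Z (z + e ν) μ‖ ^ 2 + ∑ z ∈ periodBox M, ‖Z z ν‖ ^ 2 := by
      simp only [bondSq, bondSqAt, Finset.sum_add_distrib]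
    rw [heq, hs ν (e μ), hs μ (e ν)]
    have h1 := hle μ
    have h2 := hle ν
    linarith
  calc ∑ π : T4AveragingDeficitWall.Plane d, ∑ z ∈ periodBox M, bondSq Z (z, π)
      ≤ ∑ _π : T4AveragingDeficitWall.Plane d, 4 * dirSq Z (periodBox M) := Finset.sum_le_sum fun π _ => hplane π
    _ = 4 * Fintype.card (T4AveragingDeficitWall.Plane d) * dirSq Z (periodBox M) := by
        rw [Finset.sum_const, Finset.card_univ, nsmul_eq_mul]; ring

omit [Nonempty n] in
/-- `bondSq` sums are monotone in the site set. [folklore] -/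
theorem sum_bondSq_mono (Z : Site d → Fin d → Matrix n n ℂ) {Y F : Finset (Site d)} (h : Y ⊆ F) :
    ∑ p ∈ Y ×ˢ (Finset.univ : Finset (T4AveragingDeficitWall.Plane d)), bondSq Z p
      ≤ ∑ p ∈ F ×ˢ (Finset.univ : Finset (T4AveragingDeficitWall.Plane d)), bondSq Z p := by
  refine Finset.sum_le_sum_of_subset_of_nonneg (Finset.product_subset_product_left h) fun p _ _ => ?_
  unfold NE3HessBounds.bondSq NE3HessBounds.bondSqAt; positivity

omit [Nonempty n] in
/-- **BOTH DIRECTION TERMS AGAINST THE GLOBAL ENERGY NORM**: for `Y ⊆ periodBox M`, `Z` `M`-periodic,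
`a·Σ_{Y×pl}‖d_W Z‖ + (7/2)Σ_{Y×pl} bondSq Z ≤ a·√(#Y·#Pl)·E + 14·#Pl·E²`, `E = energyNorm W Z (periodBox M)`. [folklore] -/
theorem dirTerms_le_energyNorm (W : Site d → Fin d → (Matrix n n ℂ)ˣ) {Z : Site d → Fin d → Matrix n n ℂ} (M : ℕ)
    (hM : 1 ≤ M) (hZ : IsPeriodicDir Z (M : ℤ)) {Y : Finset (Site d)} (hY : Y ⊆ periodBox M) {a : ℝ} (ha : 0 ≤ a) :
    a * ∑ p ∈ Y ×ˢ (Finset.univ : Finset (T4AveragingDeficitWall.Plane d)), ‖curl W Z p‖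
        + 7 / 2 * ∑ p ∈ Y ×ˢ (Finset.univ : Finset (T4AveragingDeficitWall.Plane d)), bondSq Z p
      ≤ a * (Real.sqrt (Y.card * Fintype.card (T4AveragingDeficitWall.Plane d)) * energyNorm W Z (periodBox M))
        + 14 * Fintype.card (T4AveragingDeficitWall.Plane d) * energyNorm W Z (periodBox M) ^ 2 := by
  have h1 := sum_norm_curl_le W Z hY
  have h2 := (sum_bondSq_mono Z hY).trans (sum_bondSq_periodBox_le M hM hZ)
  have h3 : dirSq Z (periodBox M) ≤ energyNorm W Z (periodBox M) ^ 2 := by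
    have e := curlSq_add_dirSq_eq_energyNorm_sq W Z (periodBox M)
    have h4 : 0 ≤ curlSq W Z (periodBox M) := by unfold curlSq; positivity
    linarith
  have hPl : (0 : ℝ) ≤ Fintype.card (T4AveragingDeficitWall.Plane d) := Nat.cast_nonneg _
  nlinarith [mul_le_mul_of_nonneg_left h1 ha, mul_le_mul_of_nonneg_left h3 hPl]

end

end Summit.QuantumFields.BalabanUV.T4Continuum.NE3LocalCrudePair
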